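import Mathlib.Geometry.Manifold.PartitionOfUnity
import Literature.Geometry.Kaehler.LocalFormsGlue
import Literature.Algebra.Homology.DoubleComplexExactRows
import Literature.Algebra.Homology.CechTupleFaces
import Literature.Algebra.Homology.FilteredComplexFinrank
import HarnessLib

/-!
# The Čech–de Rham double complex: de Rham cohomology from an acyclic cover

R. Bott, L. W. Tu, *Differential Forms in Algebraic Topology* (1982), §8: for an open cover
`𝔘 = (U_i)_{i ∈ ι}` of a manifold `M` the **Čech–de Rham double complex**
`K^{p,q} = C^p(𝔘, Ω^q) = Π_{(i₀,…,i_p)} Ω^q(U_{i₀…i_p})` has the Čech differential `δ`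
((8.2)–(8.4)) horizontally and the exterior derivative vertically; its rows, augmented by the
restriction `r : Ω^q(M) → C⁰(𝔘, Ω^q)`, are EXACT (Prop. 8.5, **the generalized Mayer–Vietoris
sequence**: the contracting homotopy `(K ω)_{i₀…i_{p-1}} = Σ_i ρ_i ω_{i i₀ … i_{p-1}}` built from a
partition of unity `(ρ_i)` subordinate to `𝔘`), hence `H_dR(M) ≅ H_D(K)` (Prop. 8.8), and when all
finite intersections `U_{i₀…i_p}` have no de Rham cohomology in positive degrees the columns,
augmented by the closed `0`-forms `C^p(𝔘, Z⁰)`, are exact too, so that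
**`H^n_dR(M) ≅ Hⁿ(C^•(𝔘, Z⁰_dR))`**, the Čech cohomology of the cover with coefficients in the
presheaf of closed `0`-forms = locally constant functions (Thm. 8.9 for good covers, where this is
`Ȟⁿ(𝔘; ℝ)`).

This file carries the argument out for the CONCRETE chart-wise de Rham complexes of open subsets
of `Literature.Geometry.Kaehler.LocalForms` (`smoothFormsOn I F U q ⊆ MForm I M F q`, `restrictₗ`,
`localD`, `localClosedForms`, `LocalDeRham`), using the FULL ordered Čech complex (all tuples
`J : Fin (p + 1) → ι`, Bott–Tu p. 93: it computes the same cohomology and needs no order on `ι`)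
and the abstract double-complex theorem `Literature.Algebra.Homology.ADoubleComplex.rowColEquiv`
(Weibel's Acyclic Assembly Lemma) of `DoubleComplexExactRows`:

* `cechSet U J = ⋂ k, U (J k)`; `CechForms I F U p q = Π_J smoothFormsOn (cechSet U J) q`;
  `cechδ` ((8.4), `cechδ_apply`), `cechd = (-1)^p d` (Weibel's sign trick), the anticommuting
  double complex `cechDeRham I F hU` (`δ ∘ δ = 0` is the tuple combinatorics of
  `CechTupleFaces`);
* the row augmentation `cechDeRhamRow` (`r = ` restriction from `univ`) and
  **`cechDeRham_rowExact` / `cechDeRhamRow_exact`**: Bott–Tu Prop. 8.5 from a smooth partition of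
  unity `ρ` subordinate to `𝔘` (Mathlib's `SmoothPartitionOfUnity`), for a finite index type;
* the column augmentation `cechDeRhamCol` by the Čech complex `cechClosedδ` of closed `0`-forms,
  `cechDeRhamCol_exact` (tautological) and `cechDeRham_colExact` from the hypothesis
  `∀ p q J, localClosedForms (q+1) (cechSet U J) ≤ localExactForms _ (q+1)` (every finite
  intersection is de Rham-acyclic in positive degrees);
* **`cechDeRhamEquiv`** (Bott–Tu Prop. 8.8 + Thm. 8.9, generalized from good covers to de
  Rham-acyclic covers): `Hⁿ(Ω(M), d) ≃ₗ[ℝ] Hⁿ(C^•(𝔘, Z⁰_dR), δ)`, and its corollaries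
  `nonempty_localDeRham_equiv_cechCohomology` for the tree's `LocalDeRham I F n isOpen_univ` and
  `nonempty_deRhamCohomology_equiv_cechCohomology` for `deRhamCohomology I M F n` (via
  `LocalDeRham.toDeRhamCohomology_bijective`, proved here), under
  `[FiniteDimensional ℝ E] [T2Space M] [SigmaCompactSpace M] [Fintype ι]` and `⋃ i, U i = univ`.

The companion comparison for singular cochains and the identification of both Čech complexes
with the one of locally constant functions (de Rham's theorem in the numerical form
`Literature.NumberTheory.Transcendental.finrank_deRhamCohomology_eq_bettiNumber`) are separate
files. No named facts; everything is proved.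

## References

* R. Bott, L. W. Tu, *Differential Forms in Algebraic Topology*, GTM 82, Springer 1982, §8:
  (8.1)–(8.4), Prop. 8.5, Prop. 8.8, Thm. 8.9, and p. 93. [BottTu1982Forms]
* C. A. Weibel, *An Introduction to Homological Algebra*, CUP 1994, 1.2.5 (sign trick), Lemma 2.7.3.
  [Weibel1994]
-/

noncomputable section

open scoped Manifold ContDiff Topology
open Set Filter Literature.Algebra.Homology

namespace Literature.Geometry.Kaehler

variable {E : Type*} [NormedAddCommGroup E] [NormedSpace ℝ E]
  {H : Type*} [TopologicalSpace H] {I : ModelWithCorners ℝ E H}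
  {M : Type*} [TopologicalSpace M] [ChartedSpace H M]
  {F : Type*} [NormedAddCommGroup F] [NormedSpace ℝ F]
  {ι : Type*}

/-! ### Finite intersections indexed by tuples -/

/-- The finite intersection `U_J = U_{J 0} ∩ ⋯ ∩ U_{J (n-1)}` attached to a tuple of indices
(Bott–Tu (1982), §8, `U_{α₀…α_p}`). [cite: BottTu1982Forms, §8 (8.1)] -/
def cechSet (U : ι → Set M) {n : ℕ} (J : Fin n → ι) : Set M :=
  ⋂ k, U (J k)

omit [TopologicalSpace M] in
/-- Membership in a finite intersection. [folklore] -/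
theorem mem_cechSet_iff {U : ι → Set M} {n : ℕ} {J : Fin n → ι} {x : M} :
    x ∈ cechSet U J ↔ ∀ k, x ∈ U (J k) :=
  mem_iInter

/-- Finite intersections of open sets are open. [folklore] -/
theorem isOpen_cechSet {U : ι → Set M} (hU : ∀ i, IsOpen (U i)) {n : ℕ} (J : Fin n → ι) :
    IsOpen (cechSet U J) :=
  isOpen_iInter_of_finite fun k ↦ hU (J k)

omit [TopologicalSpace M] in
/-- `U_J ⊆ U_{J ∘ θ}`: passing to a sub-tuple enlarges the intersection. [folklore] -/
theorem cechSet_subset_comp (U : ι → Set M) {m n : ℕ} (J : Fin n → ι) (θ : Fin m → Fin n) :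
    cechSet U J ⊆ cechSet U (J ∘ θ) :=
  fun _ hx ↦ mem_cechSet_iff.2 fun k ↦ mem_cechSet_iff.1 hx (θ k)

omit [TopologicalSpace M] in
/-- `U_J ⊆ U_{J k}`. [folklore] -/
theorem cechSet_subset_apply (U : ι → Set M) {n : ℕ} (J : Fin n → ι) (k : Fin n) :
    cechSet U J ⊆ U (J k) :=
  fun _ hx ↦ mem_cechSet_iff.1 hx k

omit [TopologicalSpace M] in
/-- `U_{(a, J)} = U_a ∩ U_J`. [folklore] -/
theorem cechSet_cons (U : ι → Set M) {n : ℕ} (a : ι) (J : Fin n → ι) :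
    cechSet U (Fin.cons a J : Fin (n + 1) → ι) = U a ∩ cechSet U J := by
  ext x
  simp only [mem_cechSet_iff, mem_inter_iff, Fin.forall_fin_succ, Fin.cons_zero, Fin.cons_succ]

omit [TopologicalSpace M] in
/-- The intersection attached to a `1`-tuple `(i)` is `U_i`. [folklore] -/
theorem cechSet_fin_one (U : ι → Set M) (J : Fin 1 → ι) : cechSet U J = U (J 0) := by
  ext x
  simp only [mem_cechSet_iff, Fin.forall_fin_one]

/-- Restricting twice along a sub-tuple is restricting once. [folklore] -/
theorem restr_restr_cechSet_comp (U : ι → Set M) {m n k : ℕ} (J : Fin n → ι) (θ : Fin m → Fin n)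
    (α : MForm I M F k) :
    (α.restr (cechSet U (J ∘ θ))).restr (cechSet U J) = α.restr (cechSet U J) :=
  MForm.restr_restr_of_subset (cechSet_subset_comp U J θ) α

/-- Restriction to a subset as a linear endomorphism of all forms (the bundled form of
`MForm.restr`). [folklore] -/
def MForm.restrₗ (W : Set M) (k : ℕ) : MForm I M F k →ₗ[ℝ] MForm I M F k where
  toFun α := α.restr W
  map_add' := MForm.restr_add W
  map_smul' := MForm.restr_smul W

/-- Restriction commutes with finite sums. [folklore] -/
theorem MForm.restr_sum {β : Type*} (W : Set M) {k : ℕ} (s : Finset β) (f : β → MForm I M F k) :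
    (∑ b ∈ s, f b).restr W = ∑ b ∈ s, (f b).restr W :=
  map_sum (MForm.restrₗ W k) f s

/-! ### Smooth functions with controlled support times local forms -/

/-- **Extension by zero with a cut-off**: if `g` is a smooth function with `tsupport g ⊆ V` and
`α` is a form on `V ∩ W` (smooth at its points, zero elsewhere), then `g • α` is a form on `W`:
smooth on `V ∩ W` as a product and `≡ 0` near the points of `W ∖ V` (Bott–Tu (1982), proof of
Prop. 8.5: "`ρ_α ω_{α α₀ … }` … extended by zero"). [cite: BottTu1982Forms, Prop. 8.5] -/
theorem fun_smul_mem_smoothFormsOn_of_tsupport_subset {V W : Set M} {g : M → ℝ}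
    (hg : ContMDiff I 𝓘(ℝ) ∞ g) (hgV : tsupport g ⊆ V) {k : ℕ} {α : MForm I M F k}
    (hα : α ∈ smoothFormsOn I F (V ∩ W) k) : g • α ∈ smoothFormsOn I F W k := by
  refine ⟨fun y hy ↦ ?_, fun y hy ↦ ?_⟩
  · by_cases hyV : y ∈ V
    · exact (hα.1 y ⟨hyV, hy⟩).fun_smul (hg y)
    · have h0 : g =ᶠ[𝓝 y] 0 := notMem_tsupport_iff_eventuallyEq.1 fun h ↦ hyV (hgV h)
      refine MForm.smoothAt_of_eventuallyEq_zero ?_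
      filter_upwards [h0] with z hz
      rw [Pi.smul_apply', hz, Pi.zero_apply, zero_smul]
  · rw [Pi.smul_apply', hα.2 y (fun h ↦ hy h.2), smul_zero]

/-- A function with `tsupport g ⊆ V` vanishes off `V`. [folklore] -/
theorem apply_eq_zero_of_tsupport_subset {V : Set M} {g : M → ℝ} (hgV : tsupport g ⊆ V) {y : M}
    (hy : y ∉ V) : g y = 0 :=
  Function.notMem_support.1 fun h ↦ hy (hgV (subset_tsupport _ h))

/-! ### The Čech–de Rham double complex -/

variable (I F) in
/-- **The Čech `p`-cochains with values in `q`-forms**, `C^p(𝔘, Ω^q) = Π_J Ω^q(U_J)` over ALL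
ordered `(p+1)`-tuples `J : Fin (p + 1) → ι` (Bott–Tu (1982), §8, p. 93: the full ordered complex).
[cite: BottTu1982Forms, §8 (8.1)] -/
abbrev CechForms (U : ι → Set M) (p q : ℕ) : Type _ :=
  ∀ J : Fin (p + 1) → ι, ↥(smoothFormsOn I F (cechSet U J) q)

section Cech

variable {U : ι → Set M} (hU : ∀ i, IsOpen (U i))

variable (I F) in
/-- **The Čech differential** `(δ ω)_J = Σ_j (-1)^j ω_{J ∘ σ_j}|_{U_J}`, `σ_j = Fin.succAbove j`
(Bott–Tu (1982), (8.4)). [cite: BottTu1982Forms, §8 (8.4)] -/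
def cechδ (p q : ℕ) : CechForms I F U p q →ₗ[ℝ] CechForms I F U (p + 1) q where
  toFun c J := ∑ j : Fin (p + 2), (-1 : ℝ) ^ (j : ℕ) •
    restrictₗ I F q (isOpen_cechSet hU J) (cechSet_subset_comp U J (Fin.succAbove j))
      (c (J ∘ Fin.succAbove j))
  map_add' c c' := by
    funext J
    simp only [Pi.add_apply, map_add, smul_add, Finset.sum_add_distrib]
  map_smul' r c := by
    funext J
    simp only [Pi.smul_apply, map_smul, RingHom.id_apply, Finset.smul_sum, smul_smul, mul_comm r]

/-- The Čech differential, componentwise. [cite: BottTu1982Forms, §8 (8.4)] -/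
theorem cechδ_apply {p q : ℕ} (c : CechForms I F U p q) (J : Fin (p + 2) → ι) :
    cechδ I F hU p q c J = ∑ j : Fin (p + 2), (-1 : ℝ) ^ (j : ℕ) •
      restrictₗ I F q (isOpen_cechSet hU J) (cechSet_subset_comp U J (Fin.succAbove j))
        (c (J ∘ Fin.succAbove j)) :=
  rfl

/-- The Čech differential on underlying forms. [cite: BottTu1982Forms, §8 (8.4)] -/
theorem coe_cechδ_apply {p q : ℕ} (c : CechForms I F U p q) (J : Fin (p + 2) → ι) :
    (cechδ I F hU p q c J : MForm I M F q) = ∑ j : Fin (p + 2), (-1 : ℝ) ^ (j : ℕ) •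
      (c (J ∘ Fin.succAbove j) : MForm I M F q).restr (cechSet U J) := by
  rw [cechδ_apply, Submodule.coe_sum]
  simp only [Submodule.coe_smul, coe_restrictₗ]

/-- The Čech differential on underlying forms, evaluated at a point of `U_J`. [folklore] -/
theorem coe_cechδ_apply_apply_of_mem {p q : ℕ} (c : CechForms I F U p q) {J : Fin (p + 2) → ι}
    {y : M} (hy : y ∈ cechSet U J) :
    (cechδ I F hU p q c J : MForm I M F q) y = ∑ j : Fin (p + 2), (-1 : ℝ) ^ (j : ℕ) •
      (c (J ∘ Fin.succAbove j) : MForm I M F q) y := by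
  rw [coe_cechδ_apply, Finset.sum_apply]
  refine Finset.sum_congr rfl fun j _ ↦ ?_
  rw [Pi.smul_apply, MForm.restr_apply_of_mem _ hy]

variable [IsManifold I ∞ M]

variable (I F) in
/-- **The vertical differential** `(-1)^p d` on `C^p(𝔘, Ω^•)` (Weibel's sign trick 1.2.5 applied
to the exterior derivative, so that the squares anticommute). [cite: Weibel1994, 1.2.5] -/
def cechd (p q : ℕ) : CechForms I F U p q →ₗ[ℝ] CechForms I F U p (q + 1) where
  toFun c J := (-1 : ℝ) ^ p • localD I F q (isOpen_cechSet hU J) (c J)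
  map_add' c c' := by
    funext J
    simp only [Pi.add_apply, map_add, smul_add]
  map_smul' r c := by
    funext J
    simp only [Pi.smul_apply, map_smul, RingHom.id_apply, smul_comm r]

/-- The vertical differential, componentwise. [cite: Weibel1994, 1.2.5] -/
theorem cechd_apply {p q : ℕ} (c : CechForms I F U p q) (J : Fin (p + 1) → ι) :
    cechd I F hU p q c J = (-1 : ℝ) ^ p • localD I F q (isOpen_cechSet hU J) (c J) :=
  rfl

/-- `d` commutes with the restriction along a face (an instance of `localD_restrictₗ` with all
arguments determined by the left-hand side). [folklore] -/
theorem localD_restrictₗ_face {p q : ℕ} (J : Fin (p + 2) → ι) (j : Fin (p + 2))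
    (α : smoothFormsOn I F (cechSet U (J ∘ Fin.succAbove j)) q) :
    localD I F q (isOpen_cechSet hU J)
        (restrictₗ I F q (isOpen_cechSet hU J) (cechSet_subset_comp U J (Fin.succAbove j)) α) =
      restrictₗ I F (q + 1) (isOpen_cechSet hU J) (cechSet_subset_comp U J (Fin.succAbove j))
        (localD I F q (isOpen_cechSet hU (J ∘ Fin.succAbove j)) α) :=
  localD_restrictₗ _ _ _ α

variable (I F) in
/-- **The Čech–de Rham double complex** `C^p(𝔘, Ω^q)` of an open cover, as an anticommuting
double complex (Bott–Tu (1982), §8; `δ ∘ δ = 0` is `CechTuple.sum_sum_neg_one_pow_smul_smul_faces_eq_zero`,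
`d ∘ d = 0` is `localD_localD`, anticommutation is `localD_restrictₗ` and the sign `(-1)^p`).
[cite: BottTu1982Forms, §8] -/
def cechDeRham : ADoubleComplex ℝ (CechForms I F U) where
  d p q := cechd I F hU p q
  δ p q := cechδ I F hU p q
  d_d p q c := by
    funext J
    rw [cechd_apply, cechd_apply, map_smul, localD_localD, smul_zero, smul_zero]
    rfl
  δ_δ p q c := by
    funext J
    apply Subtype.ext
    rw [coe_cechδ_apply, Pi.zero_apply, ZeroMemClass.coe_zero]
    simp_rw [coe_cechδ_apply, MForm.restr_sum, MForm.restr_smul, restr_restr_cechSet_comp,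
      Finset.smul_sum]
    exact CechTuple.sum_sum_neg_one_pow_smul_smul_faces_eq_zero (R := ℝ)
      (fun θ ↦ ((c (J ∘ θ) : MForm I M F q)).restr (cechSet U J))
  anticomm p q c := by
    funext J
    rw [Pi.add_apply, Pi.zero_apply, cechδ_apply, cechd_apply, cechδ_apply, map_sum, Finset.smul_sum,
      ← Finset.sum_add_distrib]
    refine Finset.sum_eq_zero fun j _ ↦ ?_
    rw [cechd_apply, map_smul, map_smul, localD_restrictₗ_face hU, smul_smul, smul_smul, ← add_smul,
      show (-1 : ℝ) ^ (j : ℕ) * (-1) ^ p + (-1) ^ (p + 1) * (-1) ^ (j : ℕ) = 0 by ring, zero_smul]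

/-! ### The row augmentation: restriction from `M` -/

variable (I F) in
/-- **The row augmentation** of the Čech–de Rham complex by the de Rham complex of `M`: the
restriction `r : Ω^q(M) → C⁰(𝔘, Ω^q)`, `(r ω)_{(i)} = ω|_{U_i}` (Bott–Tu (1982), (8.5)–(8.6):
`δ ∘ r = 0`). [cite: BottTu1982Forms, §8 Prop. 8.5] -/
def cechDeRhamRow :
    (cechDeRham I F hU).RowAugmentation (fun q ↦ ↥(smoothFormsOn I F (univ : Set M) q)) where
  dA q := localD I F q isOpen_univ
  ε q :=
    { toFun := fun a J ↦ restrictₗ I F q (isOpen_cechSet hU J) (subset_univ _) a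
      map_add' := fun a b ↦ by funext J; simp only [map_add, Pi.add_apply]
      map_smul' := fun c a ↦ by funext J; simp only [map_smul, Pi.smul_apply, RingHom.id_apply] }
  ε_dA q a := by
    funext J
    change restrictₗ I F (q + 1) (isOpen_cechSet hU J) (subset_univ _) (localD I F q isOpen_univ a) =
      cechd I F hU 0 q (fun J ↦ restrictₗ I F q (isOpen_cechSet hU J) (subset_univ _) a) J
    rw [cechd_apply, pow_zero, one_smul, localD_restrictₗ _ isOpen_univ]
  δ_ε q a := by
    funext J
    change cechδ I F hU 0 q (fun J ↦ restrictₗ I F q (isOpen_cechSet hU J) (subset_univ _) a) J = 0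
    apply Subtype.ext
    rw [coe_cechδ_apply, Fin.sum_univ_two, ZeroMemClass.coe_zero]
    simp only [Fin.val_zero, pow_zero, one_smul, Fin.val_one, pow_one, neg_smul, coe_restrictₗ,
      restr_restr_cechSet_comp, add_neg_cancel]

/-- The row augmentation on underlying forms. [folklore] -/
theorem coe_cechDeRhamRow_ε {q : ℕ} (a : smoothFormsOn I F (univ : Set M) q) (J : Fin 1 → ι) :
    ((cechDeRhamRow I F hU).ε q a J : MForm I M F q) = (a : MForm I M F q).restr (cechSet U J) :=
  rfl

/-! ### Exactness of the rows (Bott–Tu Prop. 8.5) -/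

section Rows

variable [Fintype ι] (ρ : SmoothPartitionOfUnity ι I M univ) (hρ : ρ.IsSubordinate U)

omit [IsManifold I ∞ M] [Fintype ι] in
include hρ in
/-- The terms `ρ_i • ω_{(i, J)}` of the contracting homotopy are forms on `U_J`.
[cite: BottTu1982Forms, Prop. 8.5] -/
theorem smul_cons_mem {p q : ℕ} (c : CechForms I F U (p + 1) q) (J : Fin (p + 1) → ι) (i : ι) :
    (ρ i : M → ℝ) • (c (Fin.cons i J : Fin (p + 2) → ι) : MForm I M F q) ∈
      smoothFormsOn I F (cechSet U J) q := by
  refine fun_smul_mem_smoothFormsOn_of_tsupport_subset (ρ i).contMDiff (hρ i) ?_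
  rw [← cechSet_cons]
  exact (c _).2

omit [IsManifold I ∞ M] in
include hρ in
/-- **The contracting homotopy** `(K ω)_J = Σ_i ρ_i ω_{(i, J)}` lands in forms on `U_J`.
[cite: BottTu1982Forms, Prop. 8.5] -/
theorem sum_smul_cons_mem {p q : ℕ} (c : CechForms I F U (p + 1) q) (J : Fin (p + 1) → ι) :
    ∑ i, (ρ i : M → ℝ) • (c (Fin.cons i J : Fin (p + 2) → ι) : MForm I M F q) ∈
      smoothFormsOn I F (cechSet U J) q :=
  Submodule.sum_mem _ fun i _ ↦ smul_cons_mem ρ hρ c J i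

omit [IsManifold I ∞ M] [Fintype ι] in
include hρ in
/-- A partition-of-unity function vanishes off its set of the cover. [folklore] -/
theorem rho_apply_eq_zero {i : ι} {y : M} (hy : y ∉ U i) : ρ i y = 0 :=
  apply_eq_zero_of_tsupport_subset (hρ i) hy

omit [IsManifold I ∞ M] in
/-- The partition of unity sums to `1` (finite index type). [folklore] -/
theorem sum_rho_apply (y : M) : ∑ i, ρ i y = 1 := by
  rw [← finsum_eq_sum_of_fintype]
  exact ρ.sum_eq_one (mem_univ y)

omit [IsManifold I ∞ M] [Fintype ι] in
/-- **The cocycle identity behind the contraction**: if `δ ω = 0` then on `U_i ∩ U_J`,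
`ω_J = Σ_j (-1)^j ω_{(i, J ∘ σ_j)}` (the `0`-th face of `(i, J)` is `J`).
[cite: BottTu1982Forms, Prop. 8.5] -/
theorem apply_eq_sum_of_cechδ_eq_zero {p q : ℕ} {c : CechForms I F U (p + 1) q}
    (hc : cechδ I F hU (p + 1) q c = 0) (J : Fin (p + 2) → ι) (i : ι) {y : M} (hyi : y ∈ U i)
    (hy : y ∈ cechSet U J) :
    (c J : MForm I M F q) y = ∑ j : Fin (p + 2), (-1 : ℝ) ^ (j : ℕ) •
      (c (Fin.cons i (J ∘ Fin.succAbove j) : Fin (p + 2) → ι) : MForm I M F q) y := by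
  have hyc : y ∈ cechSet U (Fin.cons i J : Fin (p + 3) → ι) := by
    rw [cechSet_cons]
    exact ⟨hyi, hy⟩
  have h0 : (cechδ I F hU (p + 1) q c (Fin.cons i J : Fin (p + 3) → ι) : MForm I M F q) y = 0 := by
    rw [hc]
    rfl
  rw [coe_cechδ_apply_apply_of_mem hU c hyc,
    CechTuple.sum_neg_one_pow_smul_cons_faces (R := ℝ) i J (fun S ↦ (c S : MForm I M F q) y),
    sub_eq_zero] at h0
  exact h0

omit [IsManifold I ∞ M] [Fintype ι] in
/-- **The cocycle identity in the column `0`**: if `δ ω = 0` for a `0`-cochain `ω = (ω_i)` then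
`ω_{(i)} = ω_J` on `U_i ∩ U_J` for every `1`-tuple `J`. [cite: BottTu1982Forms, Prop. 8.5] -/
theorem apply_eq_apply_of_cechδ_eq_zero {q : ℕ} {c : CechForms I F U 0 q}
    (hc : cechδ I F hU 0 q c = 0) (J : Fin 1 → ι) (i : ι) {y : M} (hyi : y ∈ U i)
    (hy : y ∈ cechSet U J) :
    (c (fun _ ↦ i) : MForm I M F q) y = (c J : MForm I M F q) y := by
  have hyc : y ∈ cechSet U (Fin.cons i J : Fin 2 → ι) := by
    rw [cechSet_cons]
    exact ⟨hyi, hy⟩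
  have h0 : (cechδ I F hU 0 q c (Fin.cons i J : Fin 2 → ι) : MForm I M F q) y = 0 := by
    rw [hc]
    rfl
  rw [coe_cechδ_apply_apply_of_mem hU c hyc, Fin.sum_univ_two, Fin.val_zero, pow_zero, one_smul,
    Fin.val_one, pow_one, neg_one_smul, add_neg_eq_zero] at h0
  have e0 : ((Fin.cons i J : Fin 2 → ι) ∘ Fin.succAbove (0 : Fin 2)) = J :=
    CechTuple.cons_comp_succAbove_zero i J
  have e1 : ((Fin.cons i J : Fin 2 → ι) ∘ Fin.succAbove (1 : Fin 2)) = fun _ ↦ i := by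
    funext k
    rw [Subsingleton.elim k 0]
    rfl
  have f0 := congrArg (fun S : Fin 1 → ι ↦ (c S : MForm I M F q) y) e0
  have f1 := congrArg (fun S : Fin 1 → ι ↦ (c S : MForm I M F q) y) e1
  exact (f0.symm.trans (h0.trans f1)).symm

include hρ in
/-- **Exactness of the Čech rows in positive columns** (Bott–Tu (1982), Prop. 8.5: if `δ ω = 0`
then `ω = δ (K ω)` for the contracting homotopy `K` of a partition of unity subordinate to the
cover). [cite: BottTu1982Forms, Prop. 8.5] -/
theorem cechDeRham_rowExact : (cechDeRham I F hU).RowExact := by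
  refine ⟨fun p q c hc ↦ ?_⟩
  refine ⟨fun J ↦ ⟨∑ i, (ρ i : M → ℝ) • (c (Fin.cons i J : Fin (p + 2) → ι) : MForm I M F q),
    sum_smul_cons_mem ρ hρ c J⟩, ?_⟩
  funext T
  apply Subtype.ext
  change (cechδ I F hU p q _ T : MForm I M F q) = (c T : MForm I M F q)
  funext y
  by_cases hy : y ∈ cechSet U T
  · rw [coe_cechδ_apply_apply_of_mem hU _ hy]
    calc ∑ j : Fin (p + 2), (-1 : ℝ) ^ (j : ℕ) •
          (∑ i, (ρ i : M → ℝ) • (c (Fin.cons i (T ∘ Fin.succAbove j) : Fin (p + 2) → ι) :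
            MForm I M F q)) y
        = ∑ i, ρ i y • ∑ j : Fin (p + 2), (-1 : ℝ) ^ (j : ℕ) •
            (c (Fin.cons i (T ∘ Fin.succAbove j) : Fin (p + 2) → ι) : MForm I M F q) y := by
          simp only [Finset.sum_apply, Pi.smul_apply', Finset.smul_sum]
          rw [Finset.sum_comm]
          exact Finset.sum_congr rfl fun i _ ↦ Finset.sum_congr rfl fun j _ ↦ smul_comm _ _ _
      _ = ∑ i, ρ i y • (c T : MForm I M F q) y := by
          refine Finset.sum_congr rfl fun i _ ↦ ?_
          by_cases hyi : y ∈ U i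
          · rw [apply_eq_sum_of_cechδ_eq_zero hU hc T i hyi hy]
          · rw [rho_apply_eq_zero ρ hρ hyi, zero_smul, zero_smul]
      _ = (c T : MForm I M F q) y := by
          rw [← Finset.sum_smul, sum_rho_apply, one_smul]
  · rw [(c T).2.2 y hy]
    exact (cechδ I F hU p q _ T).2.2 y hy

include hρ in
/-- **Exactness of the augmented rows at the column `0`** (Bott–Tu (1982), Prop. 8.5 in degree
`0`: `r` is injective because `𝔘` covers `M`, and a `δ`-cocycle `(ω_i)` glues to the global form
`Σ_i ρ_i ω_i`). [cite: BottTu1982Forms, Prop. 8.5] -/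
theorem cechDeRhamRow_exact (hcov : ∀ y : M, ∃ i, y ∈ U i) : (cechDeRhamRow I F hU).Exact := by
  constructor
  · -- injectivity of `r`
    intro q a b h
    apply Subtype.ext
    funext y
    obtain ⟨i, hyi⟩ := hcov y
    have hyU : y ∈ cechSet U (fun _ : Fin 1 ↦ i) := by
      rw [cechSet_fin_one]
      exact hyi
    have h' := congrArg (fun c : CechForms I F U 0 q ↦ (c (fun _ ↦ i) : MForm I M F q) y) h
    simp only [coe_cechDeRhamRow_ε] at h'
    rwa [MForm.restr_apply_of_mem _ hyU, MForm.restr_apply_of_mem _ hyU] at h'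
  · -- `ker δ₀ ⊆ im r`
    intro q c hc
    have hmem : ∑ i, (ρ i : M → ℝ) • (c (fun _ : Fin 1 ↦ i) : MForm I M F q) ∈
        smoothFormsOn I F (univ : Set M) q := by
      refine Submodule.sum_mem _ fun i _ ↦
        fun_smul_mem_smoothFormsOn_of_tsupport_subset (ρ i).contMDiff (hρ i) ?_
      rw [inter_univ, ← cechSet_fin_one U (fun _ ↦ i)]
      exact (c _).2
    refine ⟨⟨_, hmem⟩, ?_⟩
    funext J
    apply Subtype.ext
    rw [coe_cechDeRhamRow_ε]
    funext y
    by_cases hy : y ∈ cechSet U J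
    · -- the cocycle condition at the `2`-tuple `(i, J 0)`: `ω_{(i)} = ω_J` on `U_i ∩ U_J`
      have hcoc : ∀ i, y ∈ U i →
          (c (fun _ : Fin 1 ↦ i) : MForm I M F q) y = (c J : MForm I M F q) y :=
        fun i hyi ↦ apply_eq_apply_of_cechδ_eq_zero hU hc J i hyi hy
      rw [MForm.restr_apply_of_mem _ hy]
      simp only [Finset.sum_apply, Pi.smul_apply']
      calc ∑ i, ρ i y • (c (fun _ : Fin 1 ↦ i) : MForm I M F q) y
          = ∑ i, ρ i y • (c J : MForm I M F q) y := by
            refine Finset.sum_congr rfl fun i _ ↦ ?_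
            by_cases hyi : y ∈ U i
            · rw [hcoc i hyi]
            · rw [rho_apply_eq_zero ρ hρ hyi, zero_smul, zero_smul]
        _ = (c J : MForm I M F q) y := by rw [← Finset.sum_smul, sum_rho_apply, one_smul]
    · rw [MForm.restr_apply_of_notMem _ hy, (c J).2.2 y hy]

end Rows

/-! ### The column augmentation: closed `0`-forms -/

variable (I F) in
/-- **The Čech `p`-cochains with values in closed `0`-forms**, `C^p(𝔘, Z⁰)`, `Z⁰(U_J)` being
the locally constant functions on `U_J` (as `0`-forms, zero off `U_J`); for a good cover this is
the Čech complex `C^p(𝔘, ℝ)` of Bott–Tu (1982), Thm. 8.9. [cite: BottTu1982Forms, Thm. 8.9] -/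
abbrev CechClosedZeroForms (U : ι → Set M) (p : ℕ) : Type _ :=
  ∀ J : Fin (p + 1) → ι, ↥(localClosedForms I F 0 (cechSet U J))

variable (I F) in
/-- **The Čech differential on closed `0`-forms** (same formula (8.4); restriction preserves
closedness). [cite: BottTu1982Forms, §8 (8.4)] -/
def cechClosedδ (p : ℕ) : CechClosedZeroForms I F U p →ₗ[ℝ] CechClosedZeroForms I F U (p + 1) where
  toFun b J := ∑ j : Fin (p + 2), (-1 : ℝ) ^ (j : ℕ) •
    restrictClosedₗ I F 0 (isOpen_cechSet hU J) (cechSet_subset_comp U J (Fin.succAbove j))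
      (b (J ∘ Fin.succAbove j))
  map_add' b b' := by
    funext J
    simp only [Pi.add_apply, map_add, smul_add, Finset.sum_add_distrib]
  map_smul' r b := by
    funext J
    simp only [Pi.smul_apply, map_smul, RingHom.id_apply, Finset.smul_sum, smul_smul, mul_comm r]

omit [IsManifold I ∞ M] in
/-- The Čech differential on closed `0`-forms, on underlying forms. [cite: BottTu1982Forms, §8 (8.4)] -/
theorem coe_cechClosedδ_apply {p : ℕ} (b : CechClosedZeroForms I F U p) (J : Fin (p + 2) → ι) :
    (cechClosedδ I F hU p b J : MForm I M F 0) = ∑ j : Fin (p + 2), (-1 : ℝ) ^ (j : ℕ) •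
      (b (J ∘ Fin.succAbove j) : MForm I M F 0).restr (cechSet U J) := by
  change ((∑ j : Fin (p + 2), (-1 : ℝ) ^ (j : ℕ) •
    restrictClosedₗ I F 0 (isOpen_cechSet hU J) (cechSet_subset_comp U J (Fin.succAbove j))
      (b (J ∘ Fin.succAbove j)) : localClosedForms I F 0 (cechSet U J)) : MForm I M F 0) = _
  rw [Submodule.coe_sum]
  simp only [Submodule.coe_smul, coe_restrictClosedₗ]

variable (I F) in
/-- The inclusion `Z⁰(U_J) ↪ Ω⁰(U_J)` on Čech cochains, as a linear map. [folklore] -/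
def cechClosedIncl (p : ℕ) : CechClosedZeroForms I F U p →ₗ[ℝ] CechForms I F U p 0 where
  toFun b J := ⟨(b J : MForm I M F 0), (b J).2.1⟩
  map_add' _ _ := rfl
  map_smul' _ _ := rfl

omit [IsManifold I ∞ M] in
/-- The inclusion on underlying forms. [folklore] -/
@[simp]
theorem coe_cechClosedIncl_apply {p : ℕ} (b : CechClosedZeroForms I F U p) (J : Fin (p + 1) → ι) :
    (cechClosedIncl I F p b J : MForm I M F 0) = (b J : MForm I M F 0) :=
  rfl

variable (I F) in
/-- **The column augmentation** of the Čech–de Rham complex by the Čech complex of closed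
`0`-forms: `Z⁰(U_J) = ker (d : Ω⁰(U_J) → Ω¹(U_J))` (Bott–Tu (1982), proof of Thm. 8.9: the
augmented columns `0 → C^p(𝔘, ℝ) → C^p(𝔘, Ω⁰) → C^p(𝔘, Ω¹) → ⋯`). [cite: BottTu1982Forms, Thm. 8.9] -/
def cechDeRhamCol : (cechDeRham I F hU).ColAugmentation (CechClosedZeroForms I F U) where
  dA p := cechClosedδ I F hU p
  ε p := cechClosedIncl I F p
  ε_dA p b := by
    funext J
    apply Subtype.ext
    change (cechClosedδ I F hU p b J : MForm I M F 0) = (cechδ I F hU p 0 (cechClosedIncl I F p b) J : MForm I M F 0)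
    rw [coe_cechClosedδ_apply, coe_cechδ_apply]
    rfl
  δ_ε p b := by
    funext J
    have h := (mem_localClosedForms_iff_localD_eq_zero (isOpen_cechSet hU J)
      ⟨(b J : MForm I M F 0), (b J).2.1⟩).1 (b J).2
    change (-1 : ℝ) ^ p • localD I F 0 (isOpen_cechSet hU J) ⟨(b J : MForm I M F 0), (b J).2.1⟩ = 0
    rw [h, smul_zero]

/-- **Exactness of the augmented columns at the row `0`** (tautological: `Z⁰ = ker d₀`).
[cite: BottTu1982Forms, Thm. 8.9] -/
theorem cechDeRhamCol_exact : (cechDeRhamCol I F hU).Exact := by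
  constructor
  · intro p b b' h
    funext J
    apply Subtype.ext
    have h' := congrArg (fun c : CechForms I F U p 0 ↦ (c J : MForm I M F 0)) h
    exact h'
  · intro p c hc
    have hcl : ∀ J, (c J : MForm I M F 0) ∈ localClosedForms I F 0 (cechSet U J) := fun J ↦ by
      rw [mem_localClosedForms_iff_localD_eq_zero (isOpen_cechSet hU J)]
      have h := congrFun hc J
      change cechd I F hU p 0 c J = 0 at h
      rw [cechd_apply] at h
      exact (smul_eq_zero_iff_right (pow_ne_zero _ (by norm_num))).1 h
    exact ⟨fun J ↦ ⟨(c J : MForm I M F 0), hcl J⟩, rfl⟩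

/-- **Exactness of the columns in positive rows from acyclicity of the finite intersections**:
if every closed form of positive degree on every `U_J` is exact (`H^{q+1}_dR(U_J) = 0`; for a
good cover this is the Poincaré lemma, Bott–Tu (1982), proof of Thm. 8.9), then the columns
`(C^p(𝔘, Ω^•), (-1)^p d)` are exact in positive degrees. [cite: BottTu1982Forms, Thm. 8.9] -/
theorem cechDeRham_colExact
    (hgood : ∀ (p q : ℕ) (J : Fin (p + 1) → ι),
      localClosedForms I F (q + 1) (cechSet U J) ≤ localExactForms I F (isOpen_cechSet hU J) (q + 1)) :
    (cechDeRham I F hU).ColExact := by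
  refine ⟨fun p q c hc ↦ ?_⟩
  have hex : ∀ J, (c J : MForm I M F (q + 1)) ∈ localExactForms I F (isOpen_cechSet hU J) (q + 1) :=
    fun J ↦ by
      apply hgood
      rw [mem_localClosedForms_iff_localD_eq_zero (isOpen_cechSet hU J)]
      have h := congrFun hc J
      change cechd I F hU p (q + 1) c J = 0 at h
      rw [cechd_apply] at h
      exact (smul_eq_zero_iff_right (pow_ne_zero _ (by norm_num))).1 h
  choose β hβ using fun J ↦ (mem_localExactForms_succ_iff (isOpen_cechSet hU J)).1 (hex J)
  refine ⟨fun J ↦ (-1 : ℝ) ^ p • β J, ?_⟩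
  funext J
  change cechd I F hU p q (fun J ↦ (-1 : ℝ) ^ p • β J) J = c J
  rw [cechd_apply, map_smul, smul_smul, ← pow_add, ← two_mul, pow_mul, neg_one_sq, one_pow, one_smul]
  exact Subtype.ext (hβ J)

/-! ### The comparison `H_dR(M) ≅ H(C^•(𝔘, Z⁰))` -/

/-- **The Čech–de Rham isomorphism for a de Rham-acyclic finite cover** (Bott–Tu (1982),
Prop. 8.8 with Thm. 8.9, for the full ordered Čech complex): for a finite open cover
`𝔘 = (U_i)` of a Hausdorff σ-compact `C^∞` manifold on a finite-dimensional model all of whose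
finite intersections `U_J` have vanishing de Rham cohomology in positive degrees, the cohomology of
the de Rham complex `(Ω^•(M), d)` (here: forms on `univ` in the sense of `LocalForms`) is
isomorphic, in every degree, to the cohomology of the Čech complex `(C^•(𝔘, Z⁰_dR), δ)` of closed
`0`-forms. Both are the total cohomology of the Čech–de Rham double complex (`rowColEquiv`).
[cite: BottTu1982Forms, Thm. 8.9] -/
def cechDeRhamEquiv [FiniteDimensional ℝ E] [T2Space M] [SigmaCompactSpace M] [Fintype ι]
    (hcov : ⋃ i, U i = univ)
    (hgood : ∀ (p q : ℕ) (J : Fin (p + 1) → ι),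
      localClosedForms I F (q + 1) (cechSet U J) ≤ localExactForms I F (isOpen_cechSet hU J) (q + 1))
    (n : ℕ) :
    NatCochain.Cohomology (fun q ↦ localD I F q (isOpen_univ : IsOpen (univ : Set M))) n ≃ₗ[ℝ]
      NatCochain.Cohomology (cechClosedδ I F hU) n :=
  have hρ := (SmoothPartitionOfUnity.exists_isSubordinate I isClosed_univ U hU hcov.symm.subset).choose_spec
  ADoubleComplex.rowColEquiv (cechDeRhamRow I F hU) (cechDeRhamCol I F hU)
    (cechDeRham_rowExact hU _ hρ)
    (cechDeRhamRow_exact hU _ hρ fun y ↦ mem_iUnion.1 (hcov.symm.subset (mem_univ y)))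
    (cechDeRham_colExact hU hgood) (cechDeRhamCol_exact hU) n

/-! ### Comparison with `LocalDeRham` and with the global de Rham cohomology -/

/-- The local de Rham cohomology of an open set is the cohomology, in the sense of
`NatCochain.Cohomology`, of its de Rham complex `(Ω^•(W), d_W)`. [folklore] -/
theorem nonempty_localDeRham_equiv_cohomology {W : Set M} (hW : IsOpen W) (n : ℕ) :
    Nonempty (NatCochain.Cohomology (fun q ↦ localD I F q hW) n ≃ₗ[ℝ] LocalDeRham I F n hW) := by
  refine nonempty_subquotient_equiv (smoothFormsOn I F W n).subtype _ _ _ _ ?_ ?_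
  · ext α
    simp only [Submodule.mem_map, Submodule.subtype_apply]
    constructor
    · rintro ⟨β, hβ, rfl⟩
      exact (mem_localClosedForms_iff_localD_eq_zero hW β).2 ((NatCochain.mem_cocycles_iff _).1 hβ)
    · intro hα
      exact ⟨⟨α, hα.1⟩, (NatCochain.mem_cocycles_iff _).2
        ((mem_localClosedForms_iff_localD_eq_zero hW ⟨α, hα.1⟩).1 hα), rfl⟩
  · intro β _
    rw [Submodule.subtype_apply]
    cases n with
    | zero =>
      rw [NatCochain.coboundaries_zero, Submodule.mem_bot, localExactForms, Submodule.mem_bot,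
        ZeroMemClass.coe_eq_zero]
    | succ n =>
      rw [NatCochain.mem_coboundaries_succ_iff, mem_localExactForms_succ_iff]
      constructor
      · rintro ⟨γ, hγ⟩
        exact ⟨γ, Subtype.ext hγ⟩
      · rintro ⟨γ, rfl⟩
        exact ⟨γ, rfl⟩

/-- **de Rham cohomology of `M` from a de Rham-acyclic finite cover**, for the tree's
`LocalDeRham I F n isOpen_univ`: `H^n(univ) ≃ Hⁿ(C^•(𝔘, Z⁰_dR), δ)`. [cite: BottTu1982Forms, Thm. 8.9] -/
theorem nonempty_localDeRham_equiv_cechCohomology [FiniteDimensional ℝ E] [T2Space M]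
    [SigmaCompactSpace M] [Fintype ι] (hcov : ⋃ i, U i = univ)
    (hgood : ∀ (p q : ℕ) (J : Fin (p + 1) → ι),
      localClosedForms I F (q + 1) (cechSet U J) ≤ localExactForms I F (isOpen_cechSet hU J) (q + 1))
    (n : ℕ) :
    Nonempty (LocalDeRham I F n (isOpen_univ : IsOpen (univ : Set M)) ≃ₗ[ℝ]
      NatCochain.Cohomology (cechClosedδ I F hU) n) := by
  obtain ⟨e⟩ := nonempty_localDeRham_equiv_cohomology (I := I) (F := F)
    (isOpen_univ : IsOpen (univ : Set M)) n
  exact ⟨e.symm.trans (cechDeRhamEquiv hU hcov hgood n)⟩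

/-- An exact smooth form on `M` is an exact form on `univ` (converse of
`mem_exactSmoothForms_of_mem_localExactForms_univ`: the exact smooth forms are spanned by the
`dβ`, `β` smooth, each of which is `d_univ β`). [folklore] -/
theorem mem_localExactForms_univ_of_mem_exactSmoothForms {k : ℕ} {α : MForm I M F k}
    (hα : α ∈ exactSmoothForms I M F k) :
    α ∈ localExactForms I F (isOpen_univ : IsOpen (univ : Set M)) k := by
  cases k with
  | zero =>
    rw [exactSmoothForms, Submodule.mem_bot] at hα
    rw [hα]
    exact Submodule.zero_mem _
  | succ k =>
    rw [exactSmoothForms] at hα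
    refine (Submodule.span_le.2 ?_) hα
    rintro _ ⟨β, hβ, rfl⟩
    refine (mem_localExactForms_succ_iff isOpen_univ).2 ⟨⟨β, by rwa [smoothFormsOn_univ]⟩, ?_⟩
    rw [coe_localD, MForm.restr_univ]

/-- **`H^k(univ) → H^k_dR(M)` is bijective**: the local de Rham cohomology of `U = univ` IS the
de Rham cohomology of `ManifoldForms` (identity on representatives; injectivity by
`mem_localExactForms_univ_of_mem_exactSmoothForms`). [folklore] -/
theorem LocalDeRham.toDeRhamCohomology_bijective (k : ℕ) :
    Function.Bijective (LocalDeRham.toDeRhamCohomology I F k M) := by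
  refine ⟨?_, LocalDeRham.toDeRhamCohomology_surjective M⟩
  rw [injective_iff_map_eq_zero]
  intro c hc
  obtain ⟨α, rfl⟩ := LocalDeRham.mk_surjective isOpen_univ c
  rw [LocalDeRham.mk_eq_zero_iff]
  have h : ((⟨(α : MForm I M F k), mem_closedSmoothForms_of_mem_localClosedForms_univ α.2⟩ :
      closedSmoothForms I M F k) : MForm I M F k) - ((0 : closedSmoothForms I M F k) : MForm I M F k) ∈
        exactSmoothForms I M F k := by
    rw [← deRhamCohomology.mk_eq_mk_iff, map_zero]
    exact hc
  rw [ZeroMemClass.coe_zero, sub_zero] at h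
  exact mem_localExactForms_univ_of_mem_exactSmoothForms h

/-- `H^k(univ) ≃ H^k_dR(M)` as a linear equivalence. [folklore] -/
def LocalDeRham.equivDeRhamCohomology (k : ℕ) :
    LocalDeRham I F k (isOpen_univ : IsOpen (univ : Set M)) ≃ₗ[ℝ] deRhamCohomology I M F k :=
  LinearEquiv.ofBijective _ (LocalDeRham.toDeRhamCohomology_bijective k)

/-- **de Rham cohomology from a de Rham-acyclic finite cover** (Bott–Tu (1982), Thm. 8.9,
generalized): for a finite open cover of a Hausdorff σ-compact `C^∞` manifold on a
finite-dimensional model whose finite intersections have no de Rham cohomology in positive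
degrees, `H^n_dR(M; F) ≃ Hⁿ(C^•(𝔘, Z⁰_dR), δ)`. [cite: BottTu1982Forms, Thm. 8.9] -/
theorem nonempty_deRhamCohomology_equiv_cechCohomology [FiniteDimensional ℝ E] [T2Space M]
    [SigmaCompactSpace M] [Fintype ι] (hcov : ⋃ i, U i = univ)
    (hgood : ∀ (p q : ℕ) (J : Fin (p + 1) → ι),
      localClosedForms I F (q + 1) (cechSet U J) ≤ localExactForms I F (isOpen_cechSet hU J) (q + 1))
    (n : ℕ) :
    Nonempty (deRhamCohomology I M F n ≃ₗ[ℝ] NatCochain.Cohomology (cechClosedδ I F hU) n) := by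
  obtain ⟨e⟩ := nonempty_localDeRham_equiv_cechCohomology hU hcov hgood n (I := I) (F := F)
  exact ⟨(LocalDeRham.equivDeRhamCohomology n).symm.trans e⟩

end Cech

end Literature.Geometry.Kaehler
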